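import Summits.QuantumFields.YangMills.Theses.ThermalTraceWindow
import Summits.QuantumFields.YangMills.Theorems.FemtoTransferGapBounds
import HarnessLib

/-!
# `ThermalTraceWindow.SubFemtoTraceRatioGlue` (item stmt-QuantumFields-28293, glue of the K2 split, LINE g8-B) — PROVED

`SubFemtoFirstLevel → TwoLevelPopulation → SubFemtoTraceRatio`: given `A`, take `(k, β₀, L₀)` from K2a; for `β ≥ max β₀ 2` and
`L₀ + 2 ≤ L ≤ β^A` one has `x = (λ₁/λ₀)^L ≥ β^{-k}` (divide K2a by `λ₀^L > 0`, `levelValue_zero_su2Rep_pos`), hence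
`1 − x/2 ≤ 1 − β^{-k}/2 ≤ 1 − β^{-(k+1)}` and K2b gives `Z_phys(2L) ≤ (1 − β^{-(k+1)}) Z_phys(L)²`, i.e. K2 with exponent `k+1`.
After this file and `ThermalTraceWindowTwoLevelPopulation.lean` the open content of route `ThermalTraceWindow` is exactly
K1 `GapQuenchesFemtoEntropy` and K2a `SubFemtoFirstLevel`.

HONEST FRAMING: bookkeeping; no RG content, no summit.
-/

open Literature.MathematicalPhysics.QuantumLattice
open Summit.QuantumFields.YangMills.Theorems
open Summit.QuantumFields.YangMills.Theorems.FemtoTransferGap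

namespace Summit.QuantumFields.YangMills.Theses.ThermalTraceWindow

/-- **The K2 split glue holds** (item stmt-QuantumFields-28293). -/
theorem subFemtoTraceRatioGlue_holds : SubFemtoTraceRatioGlue := by
  unfold SubFemtoTraceRatioGlue
  intro hK hT A hA
  obtain ⟨k, β₀, L₀, hk⟩ := hK A hA
  refine ⟨k + 1, max β₀ 2, L₀ + 2, fun β hβ L _ hL hLA => ?_⟩
  have hβ0 : β₀ ≤ β := le_trans (le_max_left _ _) hβ
  have hβ2 : 2 ≤ β := le_trans (le_max_right _ _) hβ
  have hβpos : 0 < β := by linarith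
  have hL2 : 2 ≤ L := by omega
  have hfirst := hk β hβ0 L (by omega) hLA
  have htwo := hT L β (by linarith) hL2
  have hlam0 : 0 < levelValue su2Rep L β 0 := levelValue_zero_su2Rep_pos L β
  have ha0pos : 0 < levelValue su2Rep L β 0 ^ L := pow_pos hlam0 _
  -- x ≥ β^{-k}
  have hx : β ^ (-k) ≤ (levelValue su2Rep L β 1 / levelValue su2Rep L β 0) ^ L := by
    rw [div_pow, le_div_iff₀ ha0pos]
    exact hfirst
  -- β^{-(k+1)} ≤ β^{-k}/2
  have hδ : β ^ (-(k + 1)) ≤ β ^ (-k) / 2 := by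
    have : β ^ (-(k + 1)) = β ^ (-k) * β⁻¹ := by
      rw [show -(k + 1) = -k + (-1) by ring, Real.rpow_add hβpos, Real.rpow_neg_one]
    rw [this, div_eq_mul_inv]
    exact mul_le_mul_of_nonneg_left (by rw [inv_le_inv₀ hβpos (by norm_num)]; exact hβ2) (Real.rpow_nonneg hβpos.le _)
  have hsq : 0 ≤ TT.physTrace L β L ^ 2 := sq_nonneg _
  calc TT.physTrace L β (2 * L)
      ≤ (1 - (levelValue su2Rep L β 1 / levelValue su2Rep L β 0) ^ L / 2) * TT.physTrace L β L ^ 2 := htwo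
    _ ≤ (1 - β ^ (-(k + 1))) * TT.physTrace L β L ^ 2 := by
        apply mul_le_mul_of_nonneg_right _ hsq
        linarith

end Summit.QuantumFields.YangMills.Theses.ThermalTraceWindow
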